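import Literature.AlgebraicGeometry.Resolution.NormalizationInExtension
import Literature.AlgebraicGeometry.Resolution.AlterationsDimension

/-!
# Crux `Picover`, line `degree-p-tower`: the residue `stub_picoverDegP` holds in dimension `≤ 3`

Route `ResolutionOfSingularities/pAlteration`, crux `Picover` (stmt-ResolutionOfSingularities-0554).
The research residue of the line (`stub_picoverDegP`: the normalization `W^L` of a regular integral
separated finite-type `k`-scheme `W` in a degree-`p` purely inseparable extension `L/K(W)` has a
resolution) is OPEN from dimension `4`. This file records the known slice, CONDITIONAL on the
vendored named fact `CossartPiltant2019` (reduced separated quasi-excellent schemes of dimension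
`≤ 3` have resolutions): if `dim W ≤ 3` then `W^L` has a resolution — for ANY finite extension
`L/K(W)` and without regularity of `W`. Indeed `W^L → W` is a finite alteration
(`isAlteration_normalizationInι`), so `dim W^L = dim W` (`IsAlteration.topologicalKrullDim_eq`),
and `W^L` is integral, separated and of finite type over `k`.
-/

noncomputable section

set_option linter.dupNamespace false -- mandated namespace of this single-conjunct summit

open CategoryTheory AlgebraicGeometry TopologicalSpace
open Literature.AlgebraicGeometry.Resolution

namespace Summit.ResolutionOfSingularities.ResolutionOfSingularities.Theorems.Picover.DegPDimLeThree

/-- **The residue in dimension `≤ 3`, modulo Cossart–Piltant.** For an integral scheme `W`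
separated and of finite type over a field `k` with `dim W ≤ 3` and a finite extension `L/K(W)`,
the normalization `W^L` of `W` in `L` has a resolution of singularities, conditionally on the
named fact `CossartPiltant2019` (Thm. 1.1). [cite: CossartPiltant2019, Thm. 1.1] -/
theorem hasResolution_normalizationIn_of_dim_le_three (hCP : CossartPiltant2019.{0})
    {k : Type} [Field k] (W : Scheme.{0}) [IsIntegral W] (f : W ⟶ Spec (.of k)) [IsSeparated f]
    [LocallyOfFiniteType f] [QuasiCompact f] (L : Type) [Field L] [Algebra W.functionField L]
    [FiniteDimensional W.functionField L] (hdim : topologicalKrullDim W ≤ 3) :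
    Scheme.HasResolution (normalizationIn W L) := by
  haveI : IsFinite (normalizationInι W L) := isFinite_normalizationInι W L f
  have hdim' : topologicalKrullDim (normalizationIn W L) ≤ 3 := by
    rw [(isAlteration_normalizationInι W L f).topologicalKrullDim_eq f]
    exact hdim
  haveI : IsSeparated (normalizationInι W L ≫ f) := inferInstance
  haveI : LocallyOfFiniteType (normalizationInι W L ≫ f) := inferInstance
  haveI : QuasiCompact (normalizationInι W L ≫ f) := inferInstance
  exact hCP k (normalizationIn W L) (normalizationInι W L ≫ f) inferInstance inferInstance
    inferInstance inferInstance hdim'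

/-- **`stub_picoverDegP` restricted to `dim W ≤ 3`, modulo Cossart–Piltant** (the residue of the
line `degree-p-tower` in its registered shape, with the extra hypothesis `dim W ≤ 3` and the
named fact `CossartPiltant2019`; regularity of `W`, pure inseparability and the degree are not
used). [cite: CossartPiltant2019, Thm. 1.1] -/
theorem picoverDegP_of_dim_le_three : CossartPiltant2019.{0} → ∀ (p : ℕ), p.Prime → ∀ (k : Type) [Field k] [CharP k p] (W : Scheme.{0}) [IsIntegral W] (f : W ⟶ Spec (.of k)) (L : Type) [Field L] [Algebra W.functionField L], IsSeparated f → LocallyOfFiniteType f → QuasiCompact f → Scheme.IsRegular W → IsPurelyInseparable W.functionField L → Module.finrank W.functionField L = p → topologicalKrullDim W ≤ 3 → Scheme.HasResolution (normalizationIn W L) := by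
  intro hCP p hp k _ _ W _ f L _ _ _ _ _ _ _ hdeg hdim
  haveI : FiniteDimensional W.functionField L :=
    Module.finite_of_finrank_pos (by rw [hdeg]; exact hp.pos)
  exact hasResolution_normalizationIn_of_dim_le_three hCP W f L hdim

end Summit.ResolutionOfSingularities.ResolutionOfSingularities.Theorems.Picover.DegPDimLeThree

end
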